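import Summits.ABC.IUTFork.Repair.ObstructionSS19
import HarnessLib

/-!
# Block E adversary (abc-iut-E-cx, gen 3) — §M OPEN entry (b) «nonvacuity of ThetaPinned ∧ QPinned at `settingPrVolSharp`»
# is KERNEL-DECIDED, EMPTY, at the exact binder shape of abc-iut-C-cert-1's p430714 (GENERAL analytic `logv`):
# the analytic logarithm family is UNIQUE, so branch B's p442822 (`Repair.ObstructionSS19`, analytic-log instance) transfers.

PROOF-ONLY scratch/companion (0 definitions, 0 `Prop` facts; inputs consumed BY NAME): abc-iut-rp-s1's p442822
`Repair.ObstructionSS19.not_thetaPinned_settingPrVolSharp_pilotDataOfK` / `not_pinnedRegions_ofShells_settingPrVolSharp_pilotDataOfK`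
(via abc-iut-w5-d044's mover criterion p434871 and abc-iut-w5-d039's dyadic mover) are stated at `logv := analyticLogv L`;
abc-iut-C-cert-1's `not_pilotKummerIndRelated_settingPrVolSharp_of_pinned` (p430714) and abc-iut-E-t44's p438843 bind a GENERAL
`logv : PadicLogs L` with `hlog : LogvAnalytic logv`. §1 proves `LogvAnalytic logv → logv = analyticLogv L` (a `PadicLogs` family is a
Π-type of homomorphisms on units and `LogvAnalytic` prescribes every value), so (§2) the pins are EMPTY at `settingPrVolSharp (pilotDataOfK D L) hlog …`
for EVERY analytic `logv`, every initial Θ-datum `D`, every finite `L ⊇ F`, every region reading `ρ`, q-datum `qK`, column data and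
context binders — i.e. the antecedent `hpin` of p430714 (and of its `PinnedRegions3` twin) is unsatisfiable at genuine initial Θ-data AS
TYPED under DH's (Ind2) (`Real.ismDH`). TAKES NO SIDE on [IUTchIII] Cor. 3.12 or on any author (Mochizuki / Scholze–Stix / Joshi /
Dupuy–Hilado); typed ≠ proved; a vacuity record about OUR typed objects; which (Ind2) print intends is for the referee lanes (under an
ISOMETRY reading of (Ind2) no mover exists — abc-iut-c312-14 `Cor312IdentifiedIndFixes` §2 — and nothing here bears on it).
Relation to abc-iut-E-t44's p445249 (`Joshi.TestGenuinePinsVacuity`, same carrier, general `logv`): there the vacuity is stated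
UNDER an explicit mover binder triple (`not_pinnedRegions{,3}_settingPrVolSharp_of_ismDH_moves_integer`: some `g₀ ∈ Real.ismDH logv v₀`
moves some `x₀` out of the unit ball); here, at `X := pilotDataOfK D L`, NO mover hypothesis remains — branch B discharged it at a dyadic
place of `L` ([IUTchI] Def. 3.1 (a) `√−1 ∈ F`, (b) odd bad places) — and the two records agree in conclusion. The honestSetting carrier is
abc-iut-E-t41's p445387 (tame places) and is not touched here.
[cite: DupuyHilado2025, §4.9] [cite: NeukirchANT1999, Ch. II (5.5)] [claim: Mochizuki2012, status: disputed] for every [IUTch] locution.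
Axioms: standard three.
-/

noncomputable section

open NumberField IsDedekindDomain

namespace Summit.ABC.IUTFork.Joshi.GenuinePinsEmpty

open Thm311 Thm311.Real Cor312 Cor312Vol Cor312Prov Literature.IUT.LogThetaLattice Literature.IUT.LogVolume
  Literature.IUT.HodgeTheaters Literature.NumberTheory.NumberFields

/-! ## §1. Uniqueness of the analytic logarithm family -/

section Uniqueness

variable {F : Type} [Field F] [NumberField F]

/-- Two families of `p_v`-adic logarithms that are analytic at every prime coincide: `LogvAnalyticAt` prescribes the value on
every unit at every place over `p`, and every finite place lies over its residue characteristic. [cite: NeukirchANT1999, Ch. II (5.5)] -/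
theorem eq_of_logvAnalytic {logv logv' : PadicLogs F} (h : LogvAnalytic logv) (h' : LogvAnalytic logv') :
    logv = logv' := by
  funext v
  ext u
  have hv : ((residueChar F v : ℕ) : 𝓞 F) ∈ v.asIdeal := natCast_residueChar_mem F v
  exact (h ⟨residueChar F v, residueChar_prime F v⟩ v hv (Additive.toMul u)).trans
    (h' ⟨residueChar F v, residueChar_prime F v⟩ v hv (Additive.toMul u)).symm

/-- **The analytic logarithm family is unique**: `LogvAnalytic logv → logv = analyticLogv F`. [cite: NeukirchANT1999, Ch. II (5.5)] -/
theorem eq_analyticLogv_of_logvAnalytic {logv : PadicLogs F} (h : LogvAnalytic logv) : logv = analyticLogv F :=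
  eq_of_logvAnalytic h logvAnalytic_analyticLogv

end Uniqueness

/-! ## §2. The pins are EMPTY at `settingPrVolSharp (pilotDataOfK D L) hlog …` for EVERY analytic `logv` -/

section InitialK

variable {F K Fbar : Type} [Field F] [NumberField F] [Field K] [NumberField K] [Algebra F K] [Field Fbar]
  [Algebra F Fbar] [Algebra K Fbar] {E : WeierstrassCurve F} [E.IsElliptic] {l : ℕ} {Pb : BadPlacePredicates K}
  (D : InitialThetaData F K Fbar E l Pb) (L : Type) [Field L] [NumberField L] [Algebra F L]
  {logv : PadicLogs L} (hlog : LogvAnalytic logv)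
  (M : Type) [Field M] [NumberField M]
  (archPk : ∀ (j : (thetaIndex (pilotDataOfK D L)).Label) (vQ : (thetaIndex (pilotDataOfK D L)).VQ),
    Set ((logShellsDH (pilotDataOfK D L) logv).Packet j vQ))
  (archSub : ∀ (j : (thetaIndex (pilotDataOfK D L)).Label) (v : (thetaIndex (pilotDataOfK D L)).V),
    Set ((logShellsDH (pilotDataOfK D L) logv).Packet j ((thetaIndex (pilotDataOfK D L)).over v)))
  (Ψ : ℤ → ∀ v : (thetaIndex (pilotDataOfK D L)).V, v ∈ (thetaIndex (pilotDataOfK D L)).Vbad →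
    Set ((logShellsDH (pilotDataOfK D L) logv).StarPacket v))
  (act : ℤ → ∀ v : (thetaIndex (pilotDataOfK D L)).V, v ∈ (thetaIndex (pilotDataOfK D L)).Vbad →
    (logShellsDH (pilotDataOfK D L) logv).StarPacket v →
      Module.End ℚ ((logShellsDH (pilotDataOfK D L) logv).StarPacket v))
  (Mmod : ℤ → ∀ j : (thetaIndex (pilotDataOfK D L)).LabelStar,
    Set ((logShellsDH (pilotDataOfK D L) logv).GlobalPacket j.1))
  (region : ℤ → ∀ j : (thetaIndex (pilotDataOfK D L)).LabelStar, FinDivisor M →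
    ∀ vQ : (thetaIndex (pilotDataOfK D L)).VQ, Set ((logShellsDH (pilotDataOfK D L) logv).Packet j.1 vQ))
  (n : ℤ) {HT : Type} {LogLink : HT → HT → Type} {IsFull : ∀ {s t : HT}, LogLink s t → Prop}
  (lat : LGPGaussianLogThetaLattice LogLink IsFull)
  {Frd : Type} {IsoF : Frd → Frd → Type} {Ob : Frd → Type} {realify : Frd → Frd} {Strip : Type}
  {IsoS : Strip → Strip → Type}
  {Mv : ∀ v : (thetaIndex (pilotDataOfK D L)).V, v ∈ (thetaIndex (pilotDataOfK D L)).Vbad → Type}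
  [∀ v h, Monoid (Mv v h)]
  (sig : GlobalLGPFrobenioidSignature (thetaIndex (pilotDataOfK D L)).lstar (thetaIndex (pilotDataOfK D L)).V
    (· ∈ (thetaIndex (pilotDataOfK D L)).Vbad) Frd IsoF Ob realify Strip IsoS Mv)
  (split : SplittingMonoids Mv) {ObΔ : Type}
  {N : ∀ v : (thetaIndex (pilotDataOfK D L)).V, v ∈ (thetaIndex (pilotDataOfK D L)).Vbad → Type}
  [∀ v h, Monoid (N v h)] (qData : QPilotData ObΔ N)
  (tq : ∀ (pp : Nat.Primes) (x : (thetaIndex (pilotDataOfK D L)).Fibre (.inr pp)),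
    haveI : Fact (pp : ℕ).Prime := ⟨pp.2⟩; kOf (pilotDataOfK D L) pp.1 x)
  (htq0 : ∀ pp x, tq pp x ≠ 0)
  (t : ∀ (pp : Nat.Primes) (_ : Fin (pilotDataOfK D L).lstar) (x : (thetaIndex (pilotDataOfK D L)).Fibre (.inr pp)),
    haveI : Fact (pp : ℕ).Prime := ⟨pp.2⟩; kOf (pilotDataOfK D L) pp.1 x)
  (htq1 : ∀ (pp : Nat.Primes) (x : (thetaIndex (pilotDataOfK D L)).Fibre (.inr pp)),
    haveI : Fact (pp : ℕ).Prime := ⟨pp.2⟩; placeOf (pilotDataOfK D L) pp.1 x ∉ (pilotDataOfK D L).S → ‖tq pp x‖ = 1)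
  (col : ℤ → Column (logShellsDH (pilotDataOfK D L) logv))
  (ρ : (∀ v : (thetaIndex (pilotDataOfK D L)).V, v ∈ (thetaIndex (pilotDataOfK D L)).Vbad →
      Set ((logShellsDH (pilotDataOfK D L) logv).StarPacket v)) →
    ∀ (j : (thetaIndex (pilotDataOfK D L)).Label) (vQ : (thetaIndex (pilotDataOfK D L)).VQ),
      Set ((logShellsDH (pilotDataOfK D L) logv).Packet j vQ))
  (qK : ∀ v : (thetaIndex (pilotDataOfK D L)).V, v ∈ (thetaIndex (pilotDataOfK D L)).Vbad →
    Set ((logShellsDH (pilotDataOfK D L) logv).StarPacket v))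

/-- **For EVERY analytic `logv` and every initial Θ-datum, PR-1's Θ-pin fails at `settingPrVolSharp (pilotDataOfK D L) hlog …`, for
every `ρ`** (p442822's analytic-log instance transported along §1's uniqueness). [claim: Mochizuki2012, status: disputed] -/
theorem not_thetaPinned_settingPrVolSharp_pilotDataOfK_of_logvAnalytic :
    ¬ ThetaPinned
        ({ toSituation := situationPrVol (pilotDataOfK D L) hlog M archPk archSub Ψ act Mmod region, col := col } :
          LatticeSituation (thetaIndex (pilotDataOfK D L)))
        (settingPrVolSharp (pilotDataOfK D L) hlog M archPk archSub Ψ act Mmod region n lat sig split qData tq t htq0 htq1) ρ := by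
  obtain rfl : logv = analyticLogv L := eq_analyticLogv_of_logvAnalytic hlog
  exact Repair.ObstructionSS19.not_thetaPinned_settingPrVolSharp_pilotDataOfK D L M archPk archSub Ψ act Mmod region n lat sig
    split qData tq htq0 t htq1 col ρ

/-- … hence `¬ PinnedRegions` and `¬ PinnedRegions3` there, for every `ρ`, `qK`. [claim: Mochizuki2012, status: disputed] -/
theorem not_pinnedRegions_settingPrVolSharp_pilotDataOfK_of_logvAnalytic :
    ¬ PinnedRegions
        ({ toSituation := situationPrVol (pilotDataOfK D L) hlog M archPk archSub Ψ act Mmod region, col := col } :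
          LatticeSituation (thetaIndex (pilotDataOfK D L)))
        (settingPrVolSharp (pilotDataOfK D L) hlog M archPk archSub Ψ act Mmod region n lat sig split qData tq t htq0 htq1) ρ qK :=
  fun h => not_thetaPinned_settingPrVolSharp_pilotDataOfK_of_logvAnalytic D L hlog M archPk archSub Ψ act Mmod region n lat sig
    split qData tq htq0 t htq1 col ρ h.1

/-- … and `¬ PinnedRegions3` there, for every `ρ`, `qK`. [claim: Mochizuki2012, status: disputed] -/
theorem not_pinnedRegions3_settingPrVolSharp_pilotDataOfK_of_logvAnalytic :
    ¬ PinnedRegions3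
        ({ toSituation := situationPrVol (pilotDataOfK D L) hlog M archPk archSub Ψ act Mmod region, col := col } :
          LatticeSituation (thetaIndex (pilotDataOfK D L)))
        (settingPrVolSharp (pilotDataOfK D L) hlog M archPk archSub Ψ act Mmod region n lat sig split qData tq t htq0 htq1) ρ qK :=
  fun h => not_pinnedRegions_settingPrVolSharp_pilotDataOfK_of_logvAnalytic D L hlog M archPk archSub Ψ act Mmod region n lat sig
    split qData tq htq0 t htq1 col ρ qK h.1

/-- **The `hpin` antecedent of abc-iut-C-cert-1's p430714 `not_pilotKummerIndRelated_settingPrVolSharp_of_pinned` (column shape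
`LatticeSituation.ofShells (logShellsDH X logv) …`, GENERAL analytic `logv`) is UNSATISFIABLE at `X := pilotDataOfK D L` for every
initial Θ-datum** — for every `ρ`, `qK`, Frobenius-column data and Θ-divisor family: p430714 holds there VACUOUSLY, as typed under
DH's (Ind2). [claim: Mochizuki2012, status: disputed] -/
theorem not_pinnedRegions_ofShells_settingPrVolSharp_pilotDataOfK_of_logvAnalytic
    (frobAdm : ℤ → ℤ → ∀ (j : (thetaIndex (pilotDataOfK D L)).Label) (vQ : (thetaIndex (pilotDataOfK D L)).VQ),
      Set ((logShellsDH (pilotDataOfK D L) logv).Packet j vQ) → Prop)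
    (frobLogvol : ℤ → ℤ → ∀ (j : (thetaIndex (pilotDataOfK D L)).Label) (vQ : (thetaIndex (pilotDataOfK D L)).VQ),
      Set ((logShellsDH (pilotDataOfK D L) logv).Packet j vQ) → ℝ)
    (frobΨ : ℤ → ℤ → ∀ v : (thetaIndex (pilotDataOfK D L)).V, v ∈ (thetaIndex (pilotDataOfK D L)).Vbad →
      Set ((logShellsDH (pilotDataOfK D L) logv).StarPacket v))
    (frobMmod : ℤ → ℤ → ∀ j : (thetaIndex (pilotDataOfK D L)).LabelStar,
      Set ((logShellsDH (pilotDataOfK D L) logv).GlobalPacket j.1))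
    (unitImage : ℤ → ℤ → ℕ → ∀ (j : (thetaIndex (pilotDataOfK D L)).Label) (vQ : (thetaIndex (pilotDataOfK D L)).VQ),
      Set ((logShellsDH (pilotDataOfK D L) logv).Packet j vQ))
    (ballImage : ℤ → ℤ → ∀ (j : (thetaIndex (pilotDataOfK D L)).Label) (vQ : (thetaIndex (pilotDataOfK D L)).VQ),
      Set ((logShellsDH (pilotDataOfK D L) logv).Packet j vQ))
    (thetaDiv : ℤ → ℤ → LgpDivisor M (thetaIndex (pilotDataOfK D L)).lstar) :
    ¬ PinnedRegions
        (LatticeSituation.ofShells (logShellsDH (pilotDataOfK D L) logv) M archPk archSub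
          (summandPiecesPr (pilotDataOfK D L) hlog).Adm (summandPiecesPr (pilotDataOfK D L) hlog).logvol Ψ act Mmod region frobAdm
          frobLogvol frobΨ frobMmod unitImage ballImage thetaDiv)
        (settingPrVolSharp (pilotDataOfK D L) hlog M archPk archSub Ψ act Mmod region n lat sig split qData tq t htq0 htq1) ρ qK := by
  obtain rfl : logv = analyticLogv L := eq_analyticLogv_of_logvAnalytic hlog
  exact Repair.ObstructionSS19.not_pinnedRegions_ofShells_settingPrVolSharp_pilotDataOfK D L M archPk archSub Ψ act Mmod region n
    lat sig split qData tq htq0 t htq1 ρ qK frobAdm frobLogvol frobΨ frobMmod unitImage ballImage thetaDiv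

/-- … and the `PinnedRegions3` twin (the `hpin` of p430714's `not_pilotKummerIndRelated_settingPrVolSharp_of_pinned3`).
[claim: Mochizuki2012, status: disputed] -/
theorem not_pinnedRegions3_ofShells_settingPrVolSharp_pilotDataOfK_of_logvAnalytic
    (frobAdm : ℤ → ℤ → ∀ (j : (thetaIndex (pilotDataOfK D L)).Label) (vQ : (thetaIndex (pilotDataOfK D L)).VQ),
      Set ((logShellsDH (pilotDataOfK D L) logv).Packet j vQ) → Prop)
    (frobLogvol : ℤ → ℤ → ∀ (j : (thetaIndex (pilotDataOfK D L)).Label) (vQ : (thetaIndex (pilotDataOfK D L)).VQ),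
      Set ((logShellsDH (pilotDataOfK D L) logv).Packet j vQ) → ℝ)
    (frobΨ : ℤ → ℤ → ∀ v : (thetaIndex (pilotDataOfK D L)).V, v ∈ (thetaIndex (pilotDataOfK D L)).Vbad →
      Set ((logShellsDH (pilotDataOfK D L) logv).StarPacket v))
    (frobMmod : ℤ → ℤ → ∀ j : (thetaIndex (pilotDataOfK D L)).LabelStar,
      Set ((logShellsDH (pilotDataOfK D L) logv).GlobalPacket j.1))
    (unitImage : ℤ → ℤ → ℕ → ∀ (j : (thetaIndex (pilotDataOfK D L)).Label) (vQ : (thetaIndex (pilotDataOfK D L)).VQ),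
      Set ((logShellsDH (pilotDataOfK D L) logv).Packet j vQ))
    (ballImage : ℤ → ℤ → ∀ (j : (thetaIndex (pilotDataOfK D L)).Label) (vQ : (thetaIndex (pilotDataOfK D L)).VQ),
      Set ((logShellsDH (pilotDataOfK D L) logv).Packet j vQ))
    (thetaDiv : ℤ → ℤ → LgpDivisor M (thetaIndex (pilotDataOfK D L)).lstar) :
    ¬ PinnedRegions3
        (LatticeSituation.ofShells (logShellsDH (pilotDataOfK D L) logv) M archPk archSub
          (summandPiecesPr (pilotDataOfK D L) hlog).Adm (summandPiecesPr (pilotDataOfK D L) hlog).logvol Ψ act Mmod region frobAdm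
          frobLogvol frobΨ frobMmod unitImage ballImage thetaDiv)
        (settingPrVolSharp (pilotDataOfK D L) hlog M archPk archSub Ψ act Mmod region n lat sig split qData tq t htq0 htq1) ρ qK :=
  fun h => not_pinnedRegions_ofShells_settingPrVolSharp_pilotDataOfK_of_logvAnalytic D L hlog M archPk archSub Ψ act Mmod region n
    lat sig split qData tq htq0 t htq1 ρ qK frobAdm frobLogvol frobΨ frobMmod unitImage ballImage thetaDiv h.1

end InitialK

end Summit.ABC.IUTFork.Joshi.GenuinePinsEmpty

#print axioms Summit.ABC.IUTFork.Joshi.GenuinePinsEmpty.eq_analyticLogv_of_logvAnalytic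
#print axioms Summit.ABC.IUTFork.Joshi.GenuinePinsEmpty.not_pinnedRegions_ofShells_settingPrVolSharp_pilotDataOfK_of_logvAnalytic
#print axioms Summit.ABC.IUTFork.Joshi.GenuinePinsEmpty.not_pinnedRegions3_ofShells_settingPrVolSharp_pilotDataOfK_of_logvAnalytic
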